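import Summits.CriticalPhenomena.PercolationContinuityZ3.Theorems.Transplant.FKThreeApexRimStep
import Summits.CriticalPhenomena.PercolationContinuityZ3.Theorems.Transplant.FKThreeApexRigid
import Summits.CriticalPhenomena.PercolationContinuityZ3.Theorems.Transplant.FKThreeApexOmega
import HarnessLib

/-!
# Double fans `K₂ ∨ P_{m+1}`: the bivector (∧²) calculus of pinned pairs in HAT–PLÜCKER coordinates, the Bernstein splits of the
# rim step and of the spokes into SIX FIXED LINEAR OPERATORS, and the invariant-cone principle

Helper file (`--supports stmt-CriticalPhenomena-4575`), FK sub-lane `prim-bschramm-fk-3` (gen 27); builds on p205010 (kernel theorem, internal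
audit signed; external expert review pending).  No named facts, no sorries; standard axioms.  Memo `bschramm/prim-bschramm-fk-3/FAR-CROSS-II.md` §1, §5.

For a pair of edges `e, f` pinned on the two sides of a word `N` of the double-fan class the Rayleigh difference is
`Z¹⁰Z⁰¹ − Z¹¹Z⁰⁰ = val(x₁∗y₀)·val(x₀∗y₁) − val(x₁∗y₁)·val(x₀∗y₀)` with `x_σ = N x_σ⁰`.  In hat coordinates
`(u,x,y,z,v) = (Z₀, Z₀+Z_ab, Z₀+Z_ac, Z₀+Z_bc, |Z|)` (`hx, hy, hz` of `…ThreeApexOmega`) the pairing `val(X ∗ Y)` is DIAGONAL, so the Rayleigh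
difference is `q²·⟪x₀∧x₁, y₀∧y₁⟫` for the bivector **`wedgeH`** (ten Plücker coordinates) and an explicit diagonal pairing **`pairH`**
(**`rayleigh_eq_pairH`**).  The rim step `E_r = r·id + (1−r)·detach` and the spokes `AC_x = (1−x)·id + x·P_a`, `BC_y = (1−y)·id + y·P_b` act on
bivectors through the BERNSTEIN SPLITS
`∧²E_r = r²·I + r(1−r)·T_D + (1−r)²·W_D`, `∧²AC_x = (1−x)²·I + x(1−x)·T_a + x²·W_a`, `∧²BC_y = (1−y)²·I + y(1−y)·T_b + y²·W_b`
(**`wedgeH_rimStep`**, **`wedgeH_conv_edgeAC`**, **`wedgeH_conv_edgeBC`**) with six FIXED linear maps **`opTD, opWD, opTa, opWa, opTb, opWb`**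
(explicit 10×10 matrices, `q`-dependent only through `T_D, W_D`; `W_D` has rank one, `W_a, W_b` are coordinate projections, `T_a, T_b` are diagonal).
Consequently (**`IsOpCone`**, **`IsOpCone.wedgeH_rimStep_mem`**, **`IsOpCone.wedgeH_conv_edgeAC_mem`**, **`IsOpCone.wedgeH_conv_edgeBC_mem`**,
**`IsOpCone.wedgeH_conv_edgeAB_mem`**): any convex cone of bivectors closed under the six maps contains, with `x₀∧x₁`, the bivector of the pair after any
rim step (`r ∈ [0,1]`) and any spoke or axis letter (probability in `[0,1]`); and if every element of the cone pairs non-negatively with `y₀∧y₁`, the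
pinned Rayleigh inequality `val(x₁∗y₁)val(x₀∗y₀) ≤ val(x₁∗y₀)val(x₀∗y₁)` holds after every such word (**`rayleigh_of_isOpCone`**) — the
"termwise" route to negative correlation at all distances (memo §5: numerically every coefficient functional is non-negative for `q ≥ 1/2`,
CONJECTURE T; false below `q ≈ 0.423`).
[cite: Grimmett2006, §3.9 eq. (3.94) (pp. 63–64)] [folklore]
-/

noncomputable section

namespace Summit.CriticalPhenomena.PercolationContinuityZ3.Theorems

namespace FK

namespace ThreeApex

/-- A bivector of `ℝ⁵` in hat–Plücker coordinates `e_i ∧ e_j`, `i < j`, indices `u,x,y,z,v`. [folklore] -/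
@[ext] structure Biv where
  /-- coefficient of `e_u ∧ e_x` -/
  ux : ℝ
  /-- coefficient of `e_u ∧ e_y` -/
  uy : ℝ
  /-- coefficient of `e_u ∧ e_z` -/
  uz : ℝ
  /-- coefficient of `e_u ∧ e_v` -/
  uv : ℝ
  /-- coefficient of `e_x ∧ e_y` -/
  xy : ℝ
  /-- coefficient of `e_x ∧ e_z` -/
  xz : ℝ
  /-- coefficient of `e_x ∧ e_v` -/
  xv : ℝ
  /-- coefficient of `e_y ∧ e_z` -/
  yz : ℝ
  /-- coefficient of `e_y ∧ e_v` -/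
  yv : ℝ
  /-- coefficient of `e_z ∧ e_v` -/
  zv : ℝ

namespace Biv

/-- Sum of bivectors. [folklore] -/
def add (β γ : Biv) : Biv :=
  ⟨β.ux + γ.ux, β.uy + γ.uy, β.uz + γ.uz, β.uv + γ.uv, β.xy + γ.xy, β.xz + γ.xz, β.xv + γ.xv, β.yz + γ.yz, β.yv + γ.yv, β.zv + γ.zv⟩

/-- Scalar multiple of a bivector. [folklore] -/
def smul (a : ℝ) (β : Biv) : Biv :=
  ⟨a * β.ux, a * β.uy, a * β.uz, a * β.uv, a * β.xy, a * β.xz, a * β.xv, a * β.yz, a * β.yv, a * β.zv⟩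

/-- Three-term linear combination `a•β + b•γ + c•δ` (the shape of a Bernstein split). [folklore] -/
def lin3 (a : ℝ) (β : Biv) (b : ℝ) (γ : Biv) (c : ℝ) (δ : Biv) : Biv := add (smul a β) (add (smul b γ) (smul c δ))

end Biv

/-- **The bivector `X ∧ Y` in hat–Plücker coordinates** (`u = Z₀`, `x = hx`, `y = hy`, `z = hz`, `v = total`). [folklore] -/
def wedgeH (X Y : V5) : Biv :=
  ⟨X.z0 * hx Y - hx X * Y.z0, X.z0 * hy Y - hy X * Y.z0, X.z0 * hz Y - hz X * Y.z0, X.z0 * Y.total - X.total * Y.z0,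
   hx X * hy Y - hy X * hx Y, hx X * hz Y - hz X * hx Y, hx X * Y.total - X.total * hx Y,
   hy X * hz Y - hz X * hy Y, hy X * Y.total - X.total * hy Y, hz X * Y.total - X.total * hz Y⟩

/-- **The induced pairing of bivectors** `−∧²𝐁` for the diagonal hat-coordinate form `𝐁 = diag(p(1+p), −p, −p, −p, 1)`, `p = 1 − q`
(`val(X ∗ Y) = q·𝐁(X̂, Ŷ)`). [folklore] -/
def pairH (q : ℝ) (β γ : Biv) : ℝ :=
  (1 - q) ^ 2 * (2 - q) * (β.ux * γ.ux + β.uy * γ.uy + β.uz * γ.uz) - (1 - q) * (2 - q) * β.uv * γ.uv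
    - (1 - q) ^ 2 * (β.xy * γ.xy + β.xz * γ.xz + β.yz * γ.yz) + (1 - q) * (β.xv * γ.xv + β.yv * γ.yv + β.zv * γ.zv)

/-- The gluing pairing is diagonal in hat coordinates: `val_q(X ∗ Y) = q·(p(1+p)uu' − p(xx'+yy'+zz') + vv')`. [folklore] -/
theorem val_conv_hat (q : ℝ) (X Y : V5) :
    val q (conv X Y) = q * ((1 - q) * (2 - q) * X.z0 * Y.z0 - (1 - q) * (hx X * hx Y + hy X * hy Y + hz X * hz Y)
      + X.total * Y.total) := by
  simp only [val, conv, hx, hy, hz, V5.total]; ring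

/-- **The pinned Rayleigh difference is the bivector pairing**:
`val(x₁∗y₀)·val(x₀∗y₁) − val(x₁∗y₁)·val(x₀∗y₀) = q²·⟪x₀∧x₁, y₀∧y₁⟫`. [cite: Grimmett2006, §3.9 eq. (3.94) (pp. 63–64)] -/
theorem rayleigh_eq_pairH (q : ℝ) (X₀ X₁ Y₀ Y₁ : V5) :
    val q (conv X₁ Y₀) * val q (conv X₀ Y₁) - val q (conv X₁ Y₁) * val q (conv X₀ Y₀) =
      q ^ 2 * pairH q (wedgeH X₀ X₁) (wedgeH Y₀ Y₁) := by
  simp only [val_conv_hat, pairH, wedgeH]; ring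

/-! ### The six operators -/

/-- `T_D`: the polarisation `x₀∧x₁ ↦ detach x₀ ∧ x₁ + x₀ ∧ detach x₁` as a linear map of bivectors (`p = 1 − q`). [folklore] -/
def opTD (q : ℝ) (β : Biv) : Biv :=
  ⟨-(1 + 2 * (1 - q)) * β.ux + β.uv - β.xy - β.xz,
   -(1 - q) * β.uy + β.uz - β.yz,
   β.uy - (1 - q) * β.uz + β.yz,
   -(1 - q) * β.ux - (1 - q) * β.uv + β.yv + β.zv,
   (2 - q) * β.ux + q * β.xy + β.xz - β.yv,
   (2 - q) * β.ux + β.xy + q * β.xz - β.zv,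
   q * β.xv,
   (2 - q) * β.uy - (2 - q) * β.uz + 2 * β.yz,
   -(2 - q) * β.uv + (1 - q) * β.xy + 2 * β.yv + β.zv,
   -(2 - q) * β.uv + (1 - q) * β.xz + β.yv + 2 * β.zv⟩

/-- The linear form `ℓ_D = α ∧ φ` (`W_D β = ℓ_D(β)·(a∧b)`): `p(1+p)β_ux − (1+p)β_uv + pβ_xy + pβ_xz + β_yv + β_zv`. [folklore] -/
def formD (q : ℝ) (β : Biv) : ℝ :=
  (1 - q) * (2 - q) * β.ux - (2 - q) * β.uv + (1 - q) * β.xy + (1 - q) * β.xz + β.yv + β.zv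

/-- `W_D = ∧² detach`: rank one, `β ↦ ℓ_D(β)·(a∧b)` with `a∧b = e_ux + e_uv − e_xy − e_xz + e_yv + e_zv`. [folklore] -/
def opWD (q : ℝ) (β : Biv) : Biv :=
  ⟨formD q β, 0, 0, formD q β, -formD q β, -formD q β, 0, 0, formD q β, formD q β⟩

/-- `T_a`: the polarisation of the `a`-contraction `P_a = AC_1` (diagonal: `2` on `yv`, `1` on `uy,uv,xy,xv,yz,zv`, `0` on `ux,uz,xz`). [folklore] -/
def opTa (β : Biv) : Biv := ⟨0, β.uy, 0, β.uv, β.xy, 0, β.xv, β.yz, 2 * β.yv, β.zv⟩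

/-- `W_a = ∧²P_a`: the projection onto `e_y ∧ e_v`. [folklore] -/
def opWa (β : Biv) : Biv := ⟨0, 0, 0, 0, 0, 0, 0, 0, β.yv, 0⟩

/-- `T_b`: the polarisation of the `b`-contraction `P_b = BC_1`. [folklore] -/
def opTb (β : Biv) : Biv := ⟨0, 0, β.uz, β.uv, 0, β.xz, β.xv, β.yz, β.yv, 2 * β.zv⟩

/-- `W_b = ∧²P_b`: the projection onto `e_z ∧ e_v`. [folklore] -/
def opWb (β : Biv) : Biv := ⟨0, 0, 0, 0, 0, 0, 0, 0, 0, β.zv⟩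

/-- The axis letter `AB_w` scales the bivector coordinates (`u,y,z ↦ (1−w)·`, `x,v` fixed). [folklore] -/
def opAB (w : ℝ) (β : Biv) : Biv :=
  ⟨(1 - w) * β.ux, (1 - w) ^ 2 * β.uy, (1 - w) ^ 2 * β.uz, (1 - w) * β.uv, (1 - w) * β.xy, (1 - w) * β.xz, β.xv,
   (1 - w) ^ 2 * β.yz, (1 - w) * β.yv, (1 - w) * β.zv⟩

/-- `T_D` is the polarisation of `detach`. [folklore] -/
theorem opTD_wedgeH (q : ℝ) (X Y : V5) :
    opTD q (wedgeH X Y) = Biv.add (wedgeH (detach q X) Y) (wedgeH X (detach q Y)) := by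
  ext <;> simp only [opTD, wedgeH, Biv.add, detach, hx, hy, hz, V5.total] <;> ring

/-- `W_D` is `∧² detach`. [folklore] -/
theorem opWD_wedgeH (q : ℝ) (X Y : V5) : opWD q (wedgeH X Y) = wedgeH (detach q X) (detach q Y) := by
  ext <;> simp only [opWD, formD, wedgeH, detach, hx, hy, hz, V5.total] <;> ring

/-- `T_a` is the polarisation of `P_a = (edgeAC 1 ∗ ·)`. [folklore] -/
theorem opTa_wedgeH (X Y : V5) :
    opTa (wedgeH X Y) = Biv.add (wedgeH (conv (edgeAC 1) X) Y) (wedgeH X (conv (edgeAC 1) Y)) := by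
  ext <;> simp only [opTa, wedgeH, Biv.add, conv, edgeAC, hx, hy, hz, V5.total] <;> ring

/-- `W_a` is `∧² P_a`. [folklore] -/
theorem opWa_wedgeH (X Y : V5) : opWa (wedgeH X Y) = wedgeH (conv (edgeAC 1) X) (conv (edgeAC 1) Y) := by
  ext <;> simp only [opWa, wedgeH, conv, edgeAC, hx, hy, hz, V5.total] <;> ring

/-- `T_b` is the polarisation of `P_b = (edgeBC 1 ∗ ·)`. [folklore] -/
theorem opTb_wedgeH (X Y : V5) :
    opTb (wedgeH X Y) = Biv.add (wedgeH (conv (edgeBC 1) X) Y) (wedgeH X (conv (edgeBC 1) Y)) := by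
  ext <;> simp only [opTb, wedgeH, Biv.add, conv, edgeBC, hx, hy, hz, V5.total] <;> ring

/-- `W_b` is `∧² P_b`. [folklore] -/
theorem opWb_wedgeH (X Y : V5) : opWb (wedgeH X Y) = wedgeH (conv (edgeBC 1) X) (conv (edgeBC 1) Y) := by
  ext <;> simp only [opWb, wedgeH, conv, edgeBC, hx, hy, hz, V5.total] <;> ring

/-! ### The Bernstein splits -/

/-- **`∧²E_r = r²·I + r(1−r)·T_D + (1−r)²·W_D`** on the bivector of a pair. [folklore] -/
theorem wedgeH_rimStep (q r : ℝ) (X Y : V5) :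
    wedgeH (rimStep q r X) (rimStep q r Y) =
      Biv.lin3 (r ^ 2) (wedgeH X Y) (r * (1 - r)) (opTD q (wedgeH X Y)) ((1 - r) ^ 2) (opWD q (wedgeH X Y)) := by
  ext <;> simp only [wedgeH, rimStep, Biv.lin3, Biv.add, Biv.smul, opTD, opWD, formD, hx, hy, hz, V5.total] <;> ring

/-- **`∧²AC_x = (1−x)²·I + x(1−x)·T_a + x²·W_a`**. [folklore] -/
theorem wedgeH_conv_edgeAC (x : ℝ) (X Y : V5) :
    wedgeH (conv (edgeAC x) X) (conv (edgeAC x) Y) =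
      Biv.lin3 ((1 - x) ^ 2) (wedgeH X Y) (x * (1 - x)) (opTa (wedgeH X Y)) (x ^ 2) (opWa (wedgeH X Y)) := by
  ext <;> simp only [wedgeH, conv, edgeAC, Biv.lin3, Biv.add, Biv.smul, opTa, opWa, hx, hy, hz, V5.total] <;> ring

/-- **`∧²BC_y = (1−y)²·I + y(1−y)·T_b + y²·W_b`**. [folklore] -/
theorem wedgeH_conv_edgeBC (y : ℝ) (X Y : V5) :
    wedgeH (conv (edgeBC y) X) (conv (edgeBC y) Y) =
      Biv.lin3 ((1 - y) ^ 2) (wedgeH X Y) (y * (1 - y)) (opTb (wedgeH X Y)) (y ^ 2) (opWb (wedgeH X Y)) := by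
  ext <;> simp only [wedgeH, conv, edgeBC, Biv.lin3, Biv.add, Biv.smul, opTb, opWb, hx, hy, hz, V5.total] <;> ring

/-- The axis letter acts diagonally on bivectors. [folklore] -/
theorem wedgeH_conv_edgeAB (w : ℝ) (X Y : V5) :
    wedgeH (conv (edgeAB w) X) (conv (edgeAB w) Y) = opAB w (wedgeH X Y) := by
  ext <;> simp only [wedgeH, conv, edgeAB, opAB, hx, hy, hz, V5.total] <;> ring

/-! ### The invariant-cone principle -/

/-- A set of bivectors that is a convex cone (contains `0`, closed under sums and non-negative multiples) and is mapped into itself by the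
six operators `T_D, W_D, T_a, W_a, T_b, W_b` and by the axis scalings `opAB w`, `w ∈ [0,1]`. [folklore] -/
@[folklore] structure IsOpCone (q : ℝ) (K : Set Biv) : Prop where
  /-- `0 ∈ K` -/
  zero_mem : (⟨0, 0, 0, 0, 0, 0, 0, 0, 0, 0⟩ : Biv) ∈ K
  /-- closed under sums -/
  add_mem : ∀ β γ, β ∈ K → γ ∈ K → Biv.add β γ ∈ K
  /-- closed under non-negative multiples -/
  smul_mem : ∀ (a : ℝ) β, 0 ≤ a → β ∈ K → Biv.smul a β ∈ K
  /-- `T_D K ⊆ K` -/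
  td : ∀ β, β ∈ K → opTD q β ∈ K
  /-- `W_D K ⊆ K` -/
  wd : ∀ β, β ∈ K → opWD q β ∈ K
  /-- `T_a K ⊆ K` -/
  ta : ∀ β, β ∈ K → opTa β ∈ K
  /-- `W_a K ⊆ K` -/
  wa : ∀ β, β ∈ K → opWa β ∈ K
  /-- `T_b K ⊆ K` -/
  tb : ∀ β, β ∈ K → opTb β ∈ K
  /-- `W_b K ⊆ K` -/
  wb : ∀ β, β ∈ K → opWb β ∈ K
  /-- the axis scalings -/
  ab : ∀ (w : ℝ) β, 0 ≤ w → w ≤ 1 → β ∈ K → opAB w β ∈ K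

namespace IsOpCone

variable {q : ℝ} {K : Set Biv}

/-- A three-term combination with non-negative coefficients of elements of `K` lies in `K`. [folklore] -/
theorem lin3_mem (hK : IsOpCone q K) {a b c : ℝ} (ha : 0 ≤ a) (hb : 0 ≤ b) (hc : 0 ≤ c) {β γ δ : Biv}
    (hβ : β ∈ K) (hγ : γ ∈ K) (hδ : δ ∈ K) : Biv.lin3 a β b γ c δ ∈ K :=
  hK.add_mem _ _ (hK.smul_mem a β ha hβ) (hK.add_mem _ _ (hK.smul_mem b γ hb hγ) (hK.smul_mem c δ hc hδ))

/-- **Rim steps keep the pair bivector in the cone** (`r ∈ [0,1]`). [folklore] -/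
theorem wedgeH_rimStep_mem (hK : IsOpCone q K) {r : ℝ} (hr0 : 0 ≤ r) (hr1 : r ≤ 1) {X Y : V5} (h : wedgeH X Y ∈ K) :
    wedgeH (rimStep q r X) (rimStep q r Y) ∈ K := by
  rw [wedgeH_rimStep]
  exact hK.lin3_mem (by positivity) (mul_nonneg hr0 (by linarith)) (by positivity) h (hK.td _ h) (hK.wd _ h)

/-- **`a`-spokes keep the pair bivector in the cone** (`x ∈ [0,1]`). [folklore] -/
theorem wedgeH_conv_edgeAC_mem (hK : IsOpCone q K) {x : ℝ} (hx0 : 0 ≤ x) (hx1 : x ≤ 1) {X Y : V5} (h : wedgeH X Y ∈ K) :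
    wedgeH (conv (edgeAC x) X) (conv (edgeAC x) Y) ∈ K := by
  rw [wedgeH_conv_edgeAC]
  exact hK.lin3_mem (by positivity) (mul_nonneg hx0 (by linarith)) (by positivity) h (hK.ta _ h) (hK.wa _ h)

/-- **`b`-spokes keep the pair bivector in the cone** (`y ∈ [0,1]`). [folklore] -/
theorem wedgeH_conv_edgeBC_mem (hK : IsOpCone q K) {y : ℝ} (hy0 : 0 ≤ y) (hy1 : y ≤ 1) {X Y : V5} (h : wedgeH X Y ∈ K) :
    wedgeH (conv (edgeBC y) X) (conv (edgeBC y) Y) ∈ K := by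
  rw [wedgeH_conv_edgeBC]
  exact hK.lin3_mem (by positivity) (mul_nonneg hy0 (by linarith)) (by positivity) h (hK.tb _ h) (hK.wb _ h)

/-- **The axis letter keeps the pair bivector in the cone** (`w ∈ [0,1]`). [folklore] -/
theorem wedgeH_conv_edgeAB_mem (hK : IsOpCone q K) {w : ℝ} (hw0 : 0 ≤ w) (hw1 : w ≤ 1) {X Y : V5} (h : wedgeH X Y ∈ K) :
    wedgeH (conv (edgeAB w) X) (conv (edgeAB w) Y) ∈ K := by
  rw [wedgeH_conv_edgeAB]; exact hK.ab w _ hw0 hw1 h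

end IsOpCone

/-- **THE INVARIANT-CONE PRINCIPLE (pinned Rayleigh form).**  If the pair bivector `x₀ ∧ x₁` lies in an operator cone `K` all of whose elements
pair non-negatively with `y₀ ∧ y₁`, then `val(x₁∗y₁)·val(x₀∗y₀) ≤ val(x₁∗y₀)·val(x₀∗y₁)`; by the `…_mem` lemmas the hypothesis
`wedgeH x₀ x₁ ∈ K` propagates through every rim step, spoke and axis letter with probabilities in `[0,1]`. [folklore] -/
theorem rayleigh_of_isOpCone {q : ℝ} {K : Set Biv} {X₀ X₁ Y₀ Y₁ : V5} (hmem : wedgeH X₀ X₁ ∈ K)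
    (hpos : ∀ β, β ∈ K → 0 ≤ pairH q β (wedgeH Y₀ Y₁)) :
    val q (conv X₁ Y₁) * val q (conv X₀ Y₀) ≤ val q (conv X₁ Y₀) * val q (conv X₀ Y₁) := by
  have h := rayleigh_eq_pairH q X₀ X₁ Y₀ Y₁
  have h2 : 0 ≤ q ^ 2 * pairH q (wedgeH X₀ X₁) (wedgeH Y₀ Y₁) := mul_nonneg (sq_nonneg q) (hpos _ hmem)
  linarith

/-- The pairing is symmetric under exchanging the two sides together with `a ↔ b` only up to the mirror; what the principle needs is
merely that `pairH` is bilinear — recorded here: linearity in the first argument for `lin3`. [folklore] -/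
theorem pairH_lin3 (q a b c : ℝ) (β γ δ ε : Biv) :
    pairH q (Biv.lin3 a β b γ c δ) ε = a * pairH q β ε + b * pairH q γ ε + c * pairH q δ ε := by
  simp only [pairH, Biv.lin3, Biv.add, Biv.smul]; ring

end ThreeApex

end FK

end Summit.CriticalPhenomena.PercolationContinuityZ3.Theorems
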